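import Literature.Analysis.FluidPDE.Seregin2023.TypeIIEulerZoomScenario
import HarnessLib

/-!
# Seregin 2023 ↔ 2026: the polynomial Type II scenario (1.8)–(1.9) of arXiv:2304.04045 is an
# instance of the scenario excluded by Theorem 2.1 of arXiv:2606.29468

Proof-only companion (plus one cited definition) of `TypeIIEulerZoomScenario.lean` (same directory),
kernel-checking the relation recorded in that file's module docstring. Sources:
G. Seregin, *Remarks on Type II blowups of solutions to the Navier–Stokes equations*,
arXiv:2304.04045 = Commun. Pure Appl. Anal. 23 (2024) [`Seregin2023`]: the scenario (1.8)
`r_k^{(1-m₀)κ} M^{s,l}_κ(v, r_k) ≥ ε₀` along `r_k → 0` (`0 < m₀ < 1`, `ε₀ > 0`), the bound (1.9)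
`A_{m₁}(v,R) + D_m(q,R) + E_m(v,R) ≤ c` for `0 < R ≤ 1`, and the exponents (1.10)
`m₁ = 2m - 1`, `m = 2 - α`, `α = (l(3/s+1) - (m₀-1)κ) / (l(3/s+1) + (m₀-1)κ)`; and G. Seregin,
*On potential Type II blowups for the Navier–Stokes equations*, arXiv:2606.29468 (2026)
[`Seregin2026`], Theorem 2.1 (in the tree as the named fact `seregin2026_typeII_scenario_excluded`)
with p. 3 "In papers [4]-[6], the function `g` has a polynomial character: `g(r) = r^{κ(1-m₀)}` with
`0 < m₀ < 1`" and p. 4 "the function `f` has a particular form: `f(r) = r^{1-m}`".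

## What is proved here (no new named fact)

* `alpha2023 s l m₀` — the exponent `α` of [Seregin2023] (1.10) (definition, cited).
* `one_lt_alpha2023` — "It is easy to check that `α > 1`" ([Seregin2023] p. 5), under
  `1 < s`, `1 < l`, `0 < κ(s,l)`, `0 < m₀ < 1`.
* `alpha2023_exponent_identity` — the algebra behind the reduction: with `θ = α - 1`,
  `K = (1-m₀)κ`, one has `θ · l(1+3/s)/2 = (1 + θ/2) · K`, so that the exponent of `λ` in (2.4) for
  `f = λ^θ`, `g = r^K` collapses to `-θ (3/2)(1 - s/p(η))(l/s) < 0`.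
* **`seregin2026_typeII_scenario_excluded.polynomial`** — under the fact (Thm 2.1), for a suitable
  weak solution in `Q` with the weighted bound (1.9) (= `HasWeightedEnergyBound (r ↦ r^{α-1})`,
  i.e. `A_f, E_f, D_f` with `f(r) = r^{1-m} = r^{α-1}`, which are `A_{m₁}, E_m, D_m`) and exponents
  `1 < s < p(η)`, `1 < l < q(η)`, `0 < κ < l`, `0 < m₀ < 1`:
  `r^{(1-m₀)κ} M^{s,l}_κ(v, r) → 0` as `r → 0⁺` — hence (`….not_polynomialGrowth`) the growth
  condition (1.8) cannot hold along any sequence `r_k → 0`: **the hypotheses of [Seregin2023]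
  Prop. 1.2 with `s, l > 1` are never met**, which is why that proposition is not vendored as a
  separate fact. (For `s = 1` or `l = 1`, allowed in [Seregin2023] (1.7), Theorem 2.1 as printed
  — `s > 1`, `l > 1` — does not apply; nothing is claimed there.)

Nothing here is new mathematics: it is the special case `f(r) = r^{α-1}`, `g(r) = r^{(1-m₀)κ}` of a
printed theorem, with the printed exponent relation (1.10) substituted; nothing here bears on
regularity.
-/

noncomputable section

open _root_.MeasureTheory _root_.Set _root_.Filter _root_.Metric _root_.Function
  _root_.TopologicalSpace
open scoped _root_.ENNReal _root_.NNReal _root_.Topology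

namespace Literature.Analysis.FluidPDE.Seregin2023

/-- The Euler-scaling exponent `α` of [Seregin2023] (1.10):
`α = (l(3/s + 1) - (m₀ - 1)κ) / (l(3/s + 1) + (m₀ - 1)κ)`, `κ = κ(s,l)`; then `m = 2 - α`,
`m₁ = 2m - 1`. [cite: Seregin2023, (1.10) (p. 5)] -/
def alpha2023 (s l m₀ : ℝ) : ℝ :=
  (l * (3 / s + 1) - (m₀ - 1) * kappa s l) / (l * (3 / s + 1) + (m₀ - 1) * kappa s l)

section Algebra

variable {s l m₀ : ℝ}

/-- The denominator of (1.10) is positive: `l(3/s+1) - (1-m₀)κ > 0` for `1 < s`, `1 < l`, `0 < κ`,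
`0 < m₀ < 1` (indeed `κ = 3l/s + 2 - l < 3l/s + l`). [cite: Seregin2023, (1.10) (p. 5)] -/
theorem alpha2023_den_pos (hs : 1 < s) (hl : 1 < l) (hκ : 0 < kappa s l) (hm₀ : m₀ ∈ Ioo (0 : ℝ) 1) :
    0 < l * (3 / s + 1) + (m₀ - 1) * kappa s l := by
  have hl0 : (0 : ℝ) < l := by linarith
  have hs0 : (0 : ℝ) < s := by linarith
  have hκ' : kappa s l = 3 * l / s + 2 - l := kappa_eq s hl0.ne'
  have h3 : 0 < 3 * l / s := by positivity
  have h1 : kappa s l < l * (3 / s + 1) := by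
    rw [hκ', mul_add, mul_one, mul_div_assoc', mul_comm l 3]
    linarith
  have h2 : (1 - m₀) * kappa s l < kappa s l := by
    have : (1 - m₀) < 1 := by linarith [hm₀.1]
    calc (1 - m₀) * kappa s l < 1 * kappa s l := by gcongr
      _ = kappa s l := one_mul _
  nlinarith

/-- "It is easy to check that `α > 1`" ([Seregin2023] p. 5): for `1 < s`, `1 < l`, `0 < κ(s,l)` and
`0 < m₀ < 1`. [cite: Seregin2023, §1 p. 5 (after (1.10))] -/
theorem one_lt_alpha2023 (hs : 1 < s) (hl : 1 < l) (hκ : 0 < kappa s l)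
    (hm₀ : m₀ ∈ Ioo (0 : ℝ) 1) : 1 < alpha2023 s l m₀ := by
  have hden := alpha2023_den_pos hs hl hκ hm₀
  unfold alpha2023
  rw [lt_div_iff₀ hden, one_mul]
  have : 0 < (1 - m₀) * kappa s l := mul_pos (by linarith [hm₀.2]) hκ
  nlinarith

/-- The exponent identity behind the reduction: with `θ = α - 1` and `K = (1 - m₀)κ`, relation
(1.10) reads `(α - 1) · l(3/s+1) = (α + 1) · K`, i.e. `θ · l(1 + 3/s)/2 = (1 + θ/2) · K`.
[cite: Seregin2023, (1.10) (p. 5)] -/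
theorem alpha2023_exponent_identity (hs : 1 < s) (hl : 1 < l) (hκ : 0 < kappa s l)
    (hm₀ : m₀ ∈ Ioo (0 : ℝ) 1) :
    (alpha2023 s l m₀ - 1) * (l / 2 * (1 + 3 / s)) =
      (1 + (alpha2023 s l m₀ - 1) / 2) * ((1 - m₀) * kappa s l) := by
  have hden := alpha2023_den_pos hs hl hκ hm₀
  -- abbreviate `L = l(3/s+1)`, `κ = kappa s l`; the denominator of (1.10) is `D = L + (m₀-1)κ`
  set L : ℝ := l * (3 / s + 1) with hL
  set κ : ℝ := kappa s l with hκdef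
  have hD : L + (m₀ - 1) * κ ≠ 0 := hden.ne'
  have hαm : alpha2023 s l m₀ - 1 = 2 * ((1 - m₀) * κ) / (L + (m₀ - 1) * κ) := by
    unfold alpha2023
    rw [← hL, ← hκdef, div_sub_one hD]
    congr 1
    ring
  have hαp : alpha2023 s l m₀ + 1 = 2 * L / (L + (m₀ - 1) * κ) := by
    unfold alpha2023
    rw [← hL, ← hκdef, div_add_one hD]
    congr 1
    ring
  have hL' : l / 2 * (1 + 3 / s) = L / 2 := by rw [hL]; ring
  calc (alpha2023 s l m₀ - 1) * (l / 2 * (1 + 3 / s))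
      = 2 * ((1 - m₀) * κ) / (L + (m₀ - 1) * κ) * (L / 2) := by rw [hL', hαm]
    _ = 2 * L / (L + (m₀ - 1) * κ) / 2 * ((1 - m₀) * κ) := by ring
    _ = (alpha2023 s l m₀ + 1) / 2 * ((1 - m₀) * κ) := by rw [hαp]
    _ = (1 + (alpha2023 s l m₀ - 1) / 2) * ((1 - m₀) * κ) := by ring

end Algebra

/-! ## The reduction -/

namespace seregin2026_typeII_scenario_excluded

variable {v : ℝ → EuclideanSpace ℝ (Fin 3) → EuclideanSpace ℝ (Fin 3)}
  {q : ℝ → EuclideanSpace ℝ (Fin 3) → ℝ}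
  {G : ℝ → EuclideanSpace ℝ (Fin 3) → EuclideanSpace ℝ (Fin 3) →L[ℝ] EuclideanSpace ℝ (Fin 3)}
  {s l η m₀ : ℝ}

/-- **The polynomial scenario of [Seregin2023] is excluded by [Seregin2026] Thm 2.1.** Under the
named fact `seregin2026_typeII_scenario_excluded`: let `(v, q)` be a suitable weak solution in `Q`
with weak gradient `G`, let `1 < s < p(η)`, `1 < l < q(η)`, `0 < κ(s,l) < l`, `0 ≤ η ≤ 1`,
`0 < m₀ < 1`, `α = alpha2023 s l m₀` ((1.10)), and assume the weighted bound (1.9) in the form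
`A_f + E_f + D_f ≤ M₁` on `0 < r < 1` with `f(r) = r^{α-1} = r^{1-m}` (these are `A_{m₁}`, `E_m`,
`D_m`). Then `r^{(1-m₀)κ} M^{s,l}_κ(v, r) → 0` as `r → 0⁺` (in `ℝ≥0∞`). Proof: apply Thm 2.1 with
`f = r^{α-1}` (admissible, `F(a) = a^{α-1}`, `isScenarioWeight_rpow`) and `g(r) = r^{(1-m₀)κ}`;
by `alpha2023_exponent_identity` the exponent of `λ` in (2.4) equals
`-(α-1)(3/2)(1 - s/p(η))(l/s) < 0`, so (2.4) holds (`tendsto_rpow_neg_nhdsGT_zero`).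
[cite: Seregin2026, Thm 2.1 (p. 5) with p. 3–4 (polynomial `f`, `g`); Seregin2023, (1.8)–(1.10)] -/
theorem polynomial (h : seregin2026_typeII_scenario_excluded)
    (hv : IsSuitableWeakSolutionInBall 1 0 v q)
    (hG : HasWeakSpatialGradientOn
      (parabolicCylinderOpens 1 (0 : ℝ × EuclideanSpace ℝ (Fin 3))) v G)
    (hs : 1 < s) (hl : 1 < l) (hκ : 0 < kappa s l) (hκl : kappa s l < l)
    (hη : η ∈ Icc (0 : ℝ) 1) (hsp : s < pEta η) (hlq : l < qEta η) (hm₀ : m₀ ∈ Ioo (0 : ℝ) 1)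
    (hbound : ∃ M₁ : ℝ≥0,
      HasWeightedEnergyBound (fun r => r ^ (alpha2023 s l m₀ - 1)) M₁ v q G) :
    Tendsto
      (fun r : ℝ => ENNReal.ofReal (r ^ ((1 - m₀) * kappa s l)) *
        morreyM (kappa s l) s l (0 : ℝ × EuclideanSpace ℝ (Fin 3)) v r)
      (𝓝[>] 0) (𝓝 0) := by
  set θ : ℝ := alpha2023 s l m₀ - 1 with hθdef
  set K : ℝ := (1 - m₀) * kappa s l with hKdef
  have hθ : 0 < θ := by
    have := one_lt_alpha2023 hs hl hκ hm₀
    simp only [hθdef]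
    linarith
  have hK : 0 < K := mul_pos (by linarith [hm₀.2]) hκ
  have hs0 : 0 < s := by linarith
  have hl0 : 0 < l := by linarith
  -- `p(η) > 0` and `1 - s/p(η) > 0`
  have hp0 : 0 < pEta η := lt_trans hs0 hsp
  have hsp' : 0 < 1 - s / pEta η := by
    rw [sub_pos, div_lt_one hp0]
    exact hsp
  -- the exponent of `λ` in (2.4) and its sign
  set e₁ : ℝ := l / 2 * (1 + 3 / s) - 3 / 2 * (1 - s / pEta η) * (l / s) with he₁
  have hid : θ * (l / 2 * (1 + 3 / s)) = (1 + θ / 2) * K :=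
    alpha2023_exponent_identity hs hl hκ hm₀
  have hE : θ * e₁ - (1 + θ / 2) * K = -(θ * (3 / 2 * (1 - s / pEta η) * (l / s))) := by
    rw [he₁, mul_sub, hid]
    ring
  have hEneg : θ * e₁ - (1 + θ / 2) * K < 0 := by
    rw [hE, neg_lt_zero]
    have : 0 < l / s := div_pos hl0 hs0
    positivity
  -- (2.4) for `f = λ^θ`, `g = r^K`
  have h24 : Tendsto
      (fun lam : ℝ => (lam ^ θ) ^ e₁ * ((lam * Real.sqrt (lam ^ θ)) ^ K)⁻¹) (𝓝[>] 0) atTop := by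
    have hlim := tendsto_rpow_neg_nhdsGT_zero hEneg
    refine hlim.congr' ?_
    filter_upwards [self_mem_nhdsWithin] with lam hlam
    have hl' : 0 < lam := hlam
    have hsq : Real.sqrt (lam ^ θ) = lam ^ (θ / 2) := by
      rw [Real.sqrt_eq_rpow, ← Real.rpow_mul hl'.le]
      congr 1
      ring
    have h1 : (lam ^ θ) ^ e₁ = lam ^ (θ * e₁) := (Real.rpow_mul hl'.le θ e₁).symm
    have h2 : lam * Real.sqrt (lam ^ θ) = lam ^ (1 + θ / 2) := by
      rw [hsq, Real.rpow_add hl', Real.rpow_one]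
    have h3 : ((lam * Real.sqrt (lam ^ θ)) ^ K)⁻¹ = lam ^ (-((1 + θ / 2) * K)) := by
      rw [h2, ← Real.rpow_mul hl'.le, Real.rpow_neg hl'.le]
    rw [h1, h3, ← Real.rpow_add hl', sub_eq_add_neg]
  -- apply Theorem 2.1
  have hmain := h v q G (fun r => r ^ θ) (fun a => a ^ θ) (fun r => r ^ K) s l η hv hG
    (isScenarioWeight_rpow hθ) hbound (fun r hr => Real.rpow_pos_of_pos hr.1 K) hs hl hκ hκl hη
    hsp hlq h24
  simpa only [hKdef] using hmain

/-- Consequently the growth condition (1.8) of [Seregin2023] — `r_k^{(1-m₀)κ} M^{s,l}_κ(v, r_k) ≥ ε₀ > 0`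
along a sequence `r_k → 0` in `]0,1[` — is incompatible with (1.9) and (1.12) when `s, l > 1`: the
hypotheses of [Seregin2023] Prop. 1.2 (with `s, l > 1`) are never satisfied, by [Seregin2026]
Thm 2.1. [cite: Seregin2026, Thm 2.1 (p. 5) and p. 3–4; Seregin2023, Prop. 1.2 with (1.8)–(1.12)] -/
theorem not_polynomialGrowth (h : seregin2026_typeII_scenario_excluded)
    (hv : IsSuitableWeakSolutionInBall 1 0 v q)
    (hG : HasWeakSpatialGradientOn
      (parabolicCylinderOpens 1 (0 : ℝ × EuclideanSpace ℝ (Fin 3))) v G)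
    (hs : 1 < s) (hl : 1 < l) (hκ : 0 < kappa s l) (hκl : kappa s l < l)
    (hη : η ∈ Icc (0 : ℝ) 1) (hsp : s < pEta η) (hlq : l < qEta η) (hm₀ : m₀ ∈ Ioo (0 : ℝ) 1)
    (hbound : ∃ M₁ : ℝ≥0,
      HasWeightedEnergyBound (fun r => r ^ (alpha2023 s l m₀ - 1)) M₁ v q G) :
    ¬ ∃ (ε₀ : ℝ) (r : ℕ → ℝ), 0 < ε₀ ∧ (∀ k, r k ∈ Ioo (0 : ℝ) 1) ∧ Tendsto r atTop (𝓝 0) ∧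
        ∀ k, ENNReal.ofReal ε₀ ≤
          ENNReal.ofReal (r k ^ ((1 - m₀) * kappa s l)) *
            morreyM (kappa s l) s l (0 : ℝ × EuclideanSpace ℝ (Fin 3)) v (r k) := by
  rintro ⟨ε₀, r, hε₀, hr, hr0, hge⟩
  have hlim := polynomial h hv hG hs hl hκ hκl hη hsp hlq hm₀ hbound
  -- the sequence `r k` tends to `0` within `]0, ∞[`
  have hrw : Tendsto r atTop (𝓝[>] 0) :=
    tendsto_nhdsWithin_iff.2 ⟨hr0, Eventually.of_forall fun k => (hr k).1⟩
  have hseq := hlim.comp hrw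
  -- a sequence bounded below by `ofReal ε₀ > 0` cannot tend to `0`
  have hle : ENNReal.ofReal ε₀ ≤ 0 :=
    ge_of_tendsto' hseq fun k => hge k
  have : ENNReal.ofReal ε₀ = 0 := le_antisymm hle bot_le
  exact absurd (ENNReal.ofReal_eq_zero.1 this) (not_le.2 hε₀)

end seregin2026_typeII_scenario_excluded

/-! ## The scenario of [Seregin2024AxisymTypeII] (arXiv:2402.13229) is the case `s = l = 3`

G. Seregin, *A note on potential Type II blowups of axisymmetric solutions to the Navier–Stokes
equations*, arXiv:2402.13229 (2024) [`Seregin2024AxisymTypeII`], studies potential Type II blowups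
of axisymmetric suitable weak solutions in `Q` under the growth condition (1.2)
`M^{3,3}_{2,m₀}(v, r_k) := r_k^{-2m₀} ∫_{Q(r_k)} |v|³ dz ≥ c₁ > 0` "for all natural numbers `k` and
some `0 < m₀ < 1`", `r_k → 0`, together with the scenario bound (1.3)
`sup_{0<R≤1} (A_{m₁}(v,R) + D_m(q,R) + E_m(v,R)) ≤ c < ∞`, `m = 3m₀/(2+m₀)`, `m₁ = 2m - 1`, where
`A_{m₁}(v,r) = sup_t r^{-m₁} ∫_{B(r)} |v|²`, `E_m(v,r) = r^{-m} ∫_{Q(r)} |∇v|²`,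
`D_m(q,r) = r^{-2m} ∫_{Q(r)} |q|^{3/2}` (p. 2). This is the case `s = l = 3` of the polynomial
scenario above: `κ(3,3) = 2` (`kappa_three_three`); `α(3,3,m₀) = (4-m₀)/(2+m₀) = 2 - m` as printed
on p. 4 there, i.e. `α - 1 = 1 - m` (`alpha2023_three_three_sub_one`); the weights of (1.3) are
those of `f(r) = r^{1-m}` (`rpow_one_sub_weights`); `r^{(1-m₀)κ} M^{3,3}_κ(v,r) = r^{-2m₀} ∫_{Q(r)} |v|³`
(`weightedMorreyM_three_three_eq`, Tonelli); and `3 < p(0) = q(0) = 10/3` (`pEta_zero`,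
`qEta_zero`). Hence **given [Seregin2026] Thm 2.1, (1.2) and (1.3) are incompatible for every
`0 < m₀ < 1` and every suitable weak solution in `Q`, axisymmetric or not**
(`seregin2026_typeII_scenario_excluded.not_seregin2024AxisymScenario`, and `…_cknC` through the
tree's `C(v,r)`). Props. 1.1, 2.3 and Cor. 2.4 of [Seregin2024AxisymTypeII] carry (1.2)–(1.3) among
their hypotheses, and Lemma 2.1, Props. 2.2, 3.1, 4.1 there concern the Euler-scaling limit those
hypotheses produce; this is why none of them is vendored as a separate named fact. (Used from that
note: only (1.2), (1.3), `m = 3m₀/(2+m₀)`, `m₁ = 2m-1` (p. 2) and `α = 2 - m = (4-m₀)/(2+m₀)` (p. 4).)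
-/

section Seregin2024

variable {v : ℝ → EuclideanSpace ℝ (Fin 3) → EuclideanSpace ℝ (Fin 3)} {m₀ r : ℝ}

/-- `κ(3,3) = 2`: the Morrey exponent of [Seregin2026] (1.4) at `s = l = 3` is the exponent `2` of
`M^{3,3}_{2,m₀}` in [Seregin2024AxisymTypeII] (1.2). [cite: Seregin2024AxisymTypeII, (1.2) (p. 2)] -/
theorem kappa_three_three : kappa 3 3 = 2 := by
  simp only [kappa]
  norm_num

/-- `p(0) = 10/3` ([Seregin2026] (2.1) at `η = 0`). [cite: Seregin2026, (2.1) (p. 5)] -/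
theorem pEta_zero : pEta 0 = 10 / 3 := by
  simp only [pEta]
  norm_num

/-- `q(0) = 10/3` ([Seregin2026] (2.1) at `η = 0`). [cite: Seregin2026, (2.1) (p. 5)] -/
theorem qEta_zero : qEta 0 = 10 / 3 := by
  simp only [qEta]
  norm_num

/-- At `s = l = 3` the Euler-scaling exponent (1.10) of [Seregin2023] is
`α = (4 - m₀)/(2 + m₀) = 2 - m`, `m = 3m₀/(2+m₀)`, as printed in [Seregin2024AxisymTypeII] p. 4;
in the form used below, `α - 1 = 1 - m` (for `m₀ ≥ 0`).
[cite: Seregin2024AxisymTypeII, p. 4 (`α = 2 - m = (4-m₀)/(2+m₀)`)] -/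
theorem alpha2023_three_three_sub_one (hm₀ : 0 ≤ m₀) :
    alpha2023 3 3 m₀ - 1 = 1 - 3 * m₀ / (2 + m₀) := by
  have h2 : (2 : ℝ) + m₀ ≠ 0 := by positivity
  have hden : (3 : ℝ) * (3 / 3 + 1) + (m₀ - 1) * 2 ≠ 0 := by
    have : (3 : ℝ) * (3 / 3 + 1) + (m₀ - 1) * 2 = 2 * (2 + m₀) := by ring
    rw [this]
    positivity
  simp only [alpha2023, kappa_three_three]
  rw [div_sub_one hden, one_sub_div h2, div_eq_div_iff hden h2]
  ring

/-- The weights of [Seregin2024AxisymTypeII] (1.3) are those of [Seregin2026] (1.5)/(1.7) with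
`f(r) = r^{1-m}`: for `r > 0`, `f(r)²/r = r^{-m₁}` (`m₁ = 2m - 1`), `f(r)/r = r^{-m}`,
`f(r)²/r² = r^{-2m}` — so `A_f = A_{m₁}`, `E_f = E_m`, `D_f = D_m` (cf. `weightedA`, `weightedE`,
`weightedD`). [cite: Seregin2024AxisymTypeII, (1.3) (p. 2); Seregin2026, (1.5), (1.7) (p. 3)] -/
theorem rpow_one_sub_weights (hr : 0 < r) (m : ℝ) :
    (r ^ (1 - m)) ^ 2 / r = r ^ (-(2 * m - 1)) ∧ r ^ (1 - m) / r = r ^ (-m) ∧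
      (r ^ (1 - m)) ^ 2 / r ^ 2 = r ^ (-(2 * m)) := by
  have hsq : (r ^ (1 - m)) ^ 2 = r ^ ((1 - m) * 2) := by
    rw [← Real.rpow_natCast (r ^ (1 - m)) 2, ← Real.rpow_mul hr.le]
    norm_num
  have hr1 : r = r ^ (1 : ℝ) := (Real.rpow_one r).symm
  have hr2 : r ^ 2 = r ^ (2 : ℝ) := by
    rw [← Real.rpow_natCast r 2]
    norm_num
  refine ⟨?_, ?_, ?_⟩
  · rw [hsq, div_eq_iff hr.ne', ← Real.rpow_add_one hr.ne']
    congr 1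
    ring
  · rw [div_eq_iff hr.ne', ← Real.rpow_add_one hr.ne']
    congr 1
    ring
  · rw [hsq, hr2, div_eq_iff (Real.rpow_pos_of_pos hr 2).ne', ← Real.rpow_add hr]
    congr 1
    ring

/-- `∫_{Q(z,a)} |v|³ dz = ∫_{t₀-a²}^{t₀} ∫_{B(x₀,a)} |v|³ dx dt` (Tonelli on the product set
`Q(z,a) = ]t₀-a², t₀[ × B(x₀,a)`), for `v` measurable on the cylinder: the passage between the
space–time integral of [Seregin2024AxisymTypeII] (1.2) and the iterated integral of [Seregin2026]
(1.4). [cite: Seregin2024AxisymTypeII, (1.2) (p. 2); Seregin2026, (1.4) (p. 3)] -/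
theorem lintegral_parabolicCylinder_enorm_pow_three {z : ℝ × EuclideanSpace ℝ (Fin 3)} {a : ℝ}
    (hmeas : AEStronglyMeasurable (uncurry v) (volume.restrict (parabolicCylinder a z))) :
    ∫⁻ w in parabolicCylinder a z, ‖v w.1 w.2‖ₑ ^ (3 : ℕ) =
      ∫⁻ t in Ioo (z.1 - a ^ 2) z.1, ∫⁻ x in ball z.2 a, ‖v t x‖ₑ ^ (3 : ℝ) := by
  have hprod : (volume.restrict (parabolicCylinder a z) :
      Measure (ℝ × EuclideanSpace ℝ (Fin 3))) =
      (volume.restrict (Ioo (z.1 - a ^ 2) z.1)).prod (volume.restrict (ball z.2 a)) := by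
    rw [Measure.prod_restrict, ← Measure.volume_eq_prod]
    rfl
  have hf : AEMeasurable (fun w : ℝ × EuclideanSpace ℝ (Fin 3) => ‖v w.1 w.2‖ₑ ^ (3 : ℕ))
      ((volume.restrict (Ioo (z.1 - a ^ 2) z.1)).prod (volume.restrict (ball z.2 a))) := by
    rw [← hprod]
    exact hmeas.enorm.pow_const 3
  rw [hprod, lintegral_prod _ hf]
  refine lintegral_congr fun t => lintegral_congr fun x => ?_
  exact (ENNReal.rpow_ofNat _ 3).symm

/-- `r^{(1-m₀)κ(3,3)} M^{3,3}_{κ(3,3)}(v, r) = r^{-2m₀} ∫_{Q(z,r)} |v|³ dz = M^{3,3}_{2,m₀}(v, r)` for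
`r > 0`: the growth quantity of [Seregin2026] Thm 2.1 at `s = l = 3` with `g(r) = r^{2(1-m₀)}` is
the quantity of [Seregin2024AxisymTypeII] (1.2).
[cite: Seregin2024AxisymTypeII, (1.2) (p. 2); Seregin2026, (1.4) (p. 3)] -/
theorem weightedMorreyM_three_three_eq {z : ℝ × EuclideanSpace ℝ (Fin 3)} (hr : 0 < r)
    (hmeas : AEStronglyMeasurable (uncurry v) (volume.restrict (parabolicCylinder r z)))
    (m₀ : ℝ) :
    ENNReal.ofReal (r ^ ((1 - m₀) * kappa 3 3)) * morreyM (kappa 3 3) 3 3 z v r =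
      ENNReal.ofReal (r ^ (-(2 * m₀))) *
        ∫⁻ w in parabolicCylinder r z, ‖v w.1 w.2‖ₑ ^ (3 : ℕ) := by
  rw [lintegral_parabolicCylinder_enorm_pow_three hmeas, kappa_three_three]
  simp only [morreyM]
  have h1 : ∀ t, (∫⁻ x in ball z.2 r, ‖v t x‖ₑ ^ (3 : ℝ)) ^ ((3 : ℝ) / 3) =
      ∫⁻ x in ball z.2 r, ‖v t x‖ₑ ^ (3 : ℝ) := by
    intro t
    rw [div_self (by norm_num : (3 : ℝ) ≠ 0), ENNReal.rpow_one]
  simp_rw [h1]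
  rw [← mul_assoc, ← ENNReal.ofReal_mul (Real.rpow_nonneg hr.le _), ← Real.rpow_add hr]
  have he : (1 - m₀) * 2 + -2 = -(2 * m₀) := by ring
  rw [he]

/-- The quantity (1.2) through the tree's scaled cubic functional `C(v,r) = r^{-2} ∫_{Q(r)} |v|³`
(`cknC`): `r^{-2m₀} ∫_{Q(z,r)} |v|³ dz = r^{2-2m₀} C(v; Q(z,r))`, `r > 0`.
[cite: Seregin2024AxisymTypeII, (1.2) (p. 2)] -/
theorem rpow_mul_lintegral_eq_rpow_mul_cknC {z : ℝ × EuclideanSpace ℝ (Fin 3)} (hr : 0 < r)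
    (m₀ : ℝ) :
    ENNReal.ofReal (r ^ (-(2 * m₀))) * ∫⁻ w in parabolicCylinder r z, ‖v w.1 w.2‖ₑ ^ (3 : ℕ) =
      ENNReal.ofReal (r ^ (2 - 2 * m₀)) * cknC r z v := by
  rw [cknC, ← mul_assoc]
  congr 1
  rw [← ENNReal.ofReal_pow hr.le, ← ENNReal.ofReal_inv_of_pos (pow_pos hr 2),
    ← ENNReal.ofReal_mul (Real.rpow_nonneg hr.le _)]
  congr 1
  rw [← Real.rpow_natCast r 2, ← Real.rpow_neg hr.le, ← Real.rpow_add hr]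
  congr 1
  push_cast
  ring

end Seregin2024

namespace seregin2026_typeII_scenario_excluded

variable {v : ℝ → EuclideanSpace ℝ (Fin 3) → EuclideanSpace ℝ (Fin 3)}
  {q : ℝ → EuclideanSpace ℝ (Fin 3) → ℝ}
  {G : ℝ → EuclideanSpace ℝ (Fin 3) → EuclideanSpace ℝ (Fin 3) →L[ℝ] EuclideanSpace ℝ (Fin 3)}
  {m₀ : ℝ}

/-- **The scenario of [Seregin2024AxisymTypeII] is empty, given [Seregin2026] Thm 2.1.** Let `(v, q)`
be a suitable weak solution in `Q` with weak spatial gradient `G` (no symmetry assumed), let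
`0 < m₀ < 1`, `m = 3m₀/(2+m₀)`, and assume (1.3) of [Seregin2024AxisymTypeII]:
`A_{m₁}(v,R) + D_m(q,R) + E_m(v,R) ≤ c` for `0 < R < 1` (`m₁ = 2m - 1`), in the tree's vocabulary
`HasWeightedEnergyBound (r ↦ r^{1-m}) c v q G` (`rpow_one_sub_weights`). Then the growth condition
(1.2) `r_k^{-2m₀} ∫_{Q(r_k)} |v|³ dz ≥ c₁ > 0` fails along every sequence `r_k → 0` in `]0,1[`.
Proof: `not_polynomialGrowth` at `s = l = 3`, `η = 0` (`1 < 3 < 10/3 = p(0) = q(0)`,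
`0 < κ(3,3) = 2 < 3`, `α - 1 = 1 - m`) and `weightedMorreyM_three_three_eq` (measurability of `v` on
`Q(r_k) ⊆ Q` from the weak gradient's local integrability). Consequently Props. 1.1, 2.3 and
Cor. 2.4 of [Seregin2024AxisymTypeII], whose hypotheses include (1.2)–(1.3), have no instances.
[cite: Seregin2024AxisymTypeII, (1.2)–(1.3) (p. 2), Prop. 2.3 (p. 7); Seregin2026, Thm 2.1 (p. 5)] -/
theorem not_seregin2024AxisymScenario (h : seregin2026_typeII_scenario_excluded)
    (hv : IsSuitableWeakSolutionInBall 1 0 v q)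
    (hG : HasWeakSpatialGradientOn
      (parabolicCylinderOpens 1 (0 : ℝ × EuclideanSpace ℝ (Fin 3))) v G)
    (hm₀ : m₀ ∈ Ioo (0 : ℝ) 1)
    (hbound : ∃ M₁ : ℝ≥0,
      HasWeightedEnergyBound (fun r => r ^ (1 - 3 * m₀ / (2 + m₀))) M₁ v q G) :
    ¬ ∃ (c₁ : ℝ) (r : ℕ → ℝ), 0 < c₁ ∧ (∀ k, r k ∈ Ioo (0 : ℝ) 1) ∧ Tendsto r atTop (𝓝 0) ∧
        ∀ k, ENNReal.ofReal c₁ ≤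
          ENNReal.ofReal (r k ^ (-(2 * m₀))) *
            ∫⁻ w in parabolicCylinder (r k) (0 : ℝ × EuclideanSpace ℝ (Fin 3)),
              ‖v w.1 w.2‖ₑ ^ (3 : ℕ) := by
  rintro ⟨c₁, r, hc₁, hr, hr0, hge⟩
  have h3p : (3 : ℝ) < pEta 0 := by
    rw [pEta_zero]
    norm_num
  have h3q : (3 : ℝ) < qEta 0 := by
    rw [qEta_zero]
    norm_num
  have hκ : 0 < kappa 3 3 := by
    rw [kappa_three_three]
    norm_num
  have hκl : kappa 3 3 < 3 := by
    rw [kappa_three_three]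
    norm_num
  have hη : (0 : ℝ) ∈ Icc (0 : ℝ) 1 := ⟨le_rfl, zero_le_one⟩
  have hbound' : ∃ M₁ : ℝ≥0,
      HasWeightedEnergyBound (fun r => r ^ (alpha2023 3 3 m₀ - 1)) M₁ v q G := by
    rw [alpha2023_three_three_sub_one hm₀.1.le]
    exact hbound
  refine not_polynomialGrowth h hv hG (by norm_num : (1 : ℝ) < 3) (by norm_num : (1 : ℝ) < 3)
    hκ hκl hη h3p h3q hm₀ hbound' ⟨c₁, r, hc₁, hr, hr0, fun k => ?_⟩
  -- `v` is measurable on `Q(r_k) ⊆ Q` (local integrability from the weak gradient)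
  have hsub : parabolicCylinder (r k) (0 : ℝ × EuclideanSpace ℝ (Fin 3)) ⊆
      (parabolicCylinderOpens 1 (0 : ℝ × EuclideanSpace ℝ (Fin 3)) :
        Set (ℝ × EuclideanSpace ℝ (Fin 3))) := by
    rw [coe_parabolicCylinderOpens]
    have h2 : (r k) ^ 2 ≤ 1 ^ 2 := pow_le_pow_left₀ (hr k).1.le (hr k).2.le 2
    exact prod_mono (Ioo_subset_Ioo (by linarith) le_rfl) (ball_subset_ball (hr k).2.le)
  have hmeas : AEStronglyMeasurable (uncurry v)
      (volume.restrict (parabolicCylinder (r k) (0 : ℝ × EuclideanSpace ℝ (Fin 3)))) :=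
    hG.locallyIntegrableOn.aestronglyMeasurable.mono_set hsub
  rw [weightedMorreyM_three_three_eq (hr k).1 hmeas m₀]
  exact hge k

/-- The same exclusion with (1.2) written through the tree's `C(v,r) = r^{-2} ∫_{Q(r)} |v|³`
(`cknC`): under (1.3), `r_k^{2-2m₀} C(v; Q(r_k)) ≥ c₁ > 0` fails along every `r_k → 0` in `]0,1[`.
[cite: Seregin2024AxisymTypeII, (1.2)–(1.3) (p. 2); Seregin2026, Thm 2.1 (p. 5)] -/
theorem not_seregin2024AxisymScenario_cknC (h : seregin2026_typeII_scenario_excluded)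
    (hv : IsSuitableWeakSolutionInBall 1 0 v q)
    (hG : HasWeakSpatialGradientOn
      (parabolicCylinderOpens 1 (0 : ℝ × EuclideanSpace ℝ (Fin 3))) v G)
    (hm₀ : m₀ ∈ Ioo (0 : ℝ) 1)
    (hbound : ∃ M₁ : ℝ≥0,
      HasWeightedEnergyBound (fun r => r ^ (1 - 3 * m₀ / (2 + m₀))) M₁ v q G) :
    ¬ ∃ (c₁ : ℝ) (r : ℕ → ℝ), 0 < c₁ ∧ (∀ k, r k ∈ Ioo (0 : ℝ) 1) ∧ Tendsto r atTop (𝓝 0) ∧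
        ∀ k, ENNReal.ofReal c₁ ≤
          ENNReal.ofReal (r k ^ (2 - 2 * m₀)) *
            cknC (r k) (0 : ℝ × EuclideanSpace ℝ (Fin 3)) v := by
  rintro ⟨c₁, r, hc₁, hr, hr0, hge⟩
  refine not_seregin2024AxisymScenario h hv hG hm₀ hbound ⟨c₁, r, hc₁, hr, hr0, fun k => ?_⟩
  rw [rpow_mul_lintegral_eq_rpow_mul_cknC (hr k).1 m₀]
  exact hge k

end seregin2026_typeII_scenario_excluded


/-! ## [Seregin2025TypeIIScenario] Thm 1.1 (arXiv:2507.08733): its conclusion follows from its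
hypothesis (1.1) alone, given [Seregin2026] Thm 2.1

G. Seregin, *A note on impossible scenario of Type II blowups of suitable weak solutions to the
Navier–Stokes equations*, arXiv:2507.08733 (2025; v1) [`Seregin2025TypeIIScenario`], Thm 1.1
(p. 2): for a suitable weak solution `(v, q)` in `Q` with
(1.1) `M₁ = sup_{0<r<1} {A_{m₁}(v,r) + E_m(v,r) + D_m(q,r)} < ∞` for some `0 < m < 1`, `m₁ = 2m-1`,
(1.2) `M₂ = sup_{0<r<1} N^{s₁,l₁}(v,r) < ∞`, the Ladyzhenskaya–Prodi–Serrin-type condition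
(1.3)–(1.4) `v ∈ L_{s₂,l₂}(Q)`, `3/s₂ + (α+1)/l₂ = α`, `α = 2 - m` (and (1.5) in the borderline case
`m = 1/2`, `l₂ = ∞`), one has (1.6) `lim_{r→0} C_{m₀}(v,r) = 0`, where
`C_m(v,r) = r^{-2m} ∫_{Q(r)} |v|³ dz` and `m₀ = 2m/(3-m)`. Remark 1.2 (i) there (p. 3): with
`s = l = 3`, `κ = l(3/s+2/l-1) = 2`, one has `α = (l(3/s+1)-(m₀-1)κ)/(l(3/s+1)+(m₀-1)κ) =
(4-m₀)/(2+m₀) = 2-m` and `M^{3,3}_{2,m₀}(v,r) = C_{m₀}(v,r)` — the identification proved above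
(`alpha2023_three_three_sub_one`, `weightedMorreyM_three_three_eq`; `m₀ = 2m/(3-m) ⇔
m = 3m₀/(2+m₀)`, `m_eq_of_m0`). Given the later theorem [Seregin2026] Thm 2.1 (the named fact
`seregin2026_typeII_scenario_excluded`), (1.6) follows from (1.1) **alone**, without (1.2)–(1.5):
`seregin2026_typeII_scenario_excluded.tendsto_cubic_seregin2025` below (`polynomial` at
`s = l = 3`, `η = 0`). This is why Thm 1.1 of [Seregin2025TypeIIScenario] is not vendored as a
separate named fact (it would add an unproved fact implied by an existing one); its vocabulary
`N^{s₁,l₁}` (exponent `γ_* = 1 - (3/(2s₁) - 1)(1 - m)`, [Seregin2024AxisymTypeII] (1.5)) is not needed.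
-/

section Seregin2025

variable {m : ℝ}

/-- The two parametrisations: `m₀ = 2m/(3-m)` ([Seregin2025TypeIIScenario] Thm 1.1) iff
`m = 3m₀/(2+m₀)` ([Seregin2024AxisymTypeII] (1.3)); here the direction used below, for `m < 3`.
[cite: Seregin2025TypeIIScenario, Thm 1.1 (1.6) (p. 2); Seregin2024AxisymTypeII, (1.3) (p. 2)] -/
theorem m_eq_of_m0 (hm : m < 3) : 3 * (2 * m / (3 - m)) / (2 + 2 * m / (3 - m)) = m := by
  have h3 : (3 : ℝ) - m ≠ 0 := by linarith
  have h6 : (2 : ℝ) + 2 * m / (3 - m) = 6 / (3 - m) := by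
    field_simp
    ring
  rw [h6]
  field_simp
  ring

/-- For `0 < m < 1`, `m₀ = 2m/(3-m) ∈ ]0,1[`. [cite: Seregin2025TypeIIScenario, Thm 1.1 (p. 2)] -/
theorem m0_mem_Ioo (hm : m ∈ Ioo (0 : ℝ) 1) : 2 * m / (3 - m) ∈ Ioo (0 : ℝ) 1 := by
  have h3 : (0 : ℝ) < 3 - m := by linarith [hm.2]
  refine ⟨div_pos (by linarith [hm.1]) h3, ?_⟩
  rw [div_lt_one h3]
  linarith [hm.2]

end Seregin2025

namespace seregin2026_typeII_scenario_excluded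

variable {v : ℝ → EuclideanSpace ℝ (Fin 3) → EuclideanSpace ℝ (Fin 3)}
  {q : ℝ → EuclideanSpace ℝ (Fin 3) → ℝ}
  {G : ℝ → EuclideanSpace ℝ (Fin 3) → EuclideanSpace ℝ (Fin 3) →L[ℝ] EuclideanSpace ℝ (Fin 3)}
  {m : ℝ}

/-- **The conclusion (1.6) of [Seregin2025TypeIIScenario] Thm 1.1 from its hypothesis (1.1) alone,
given [Seregin2026] Thm 2.1.** Let `(v, q)` be a suitable weak solution in `Q` with weak spatial
gradient `G`, `0 < m < 1`, and assume (1.1): `A_{m₁}(v,r) + E_m(v,r) + D_m(q,r) ≤ M₁` for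
`0 < r < 1`, `m₁ = 2m - 1` — `HasWeightedEnergyBound (r ↦ r^{1-m}) M₁ v q G`
(`rpow_one_sub_weights`). Then `C_{m₀}(v,r) = r^{-2m₀} ∫_{Q(r)} |v|³ dz → 0` as `r → 0⁺`,
`m₀ = 2m/(3-m)` — the printed conclusion (1.6), here WITHOUT the hypotheses (1.2) (`M₂`),
(1.3)–(1.4) (`v ∈ L_{s₂,l₂}`, `3/s₂ + (α+1)/l₂ = α`) and (1.5). Proof: `polynomial` at `s = l = 3`,
`η = 0`, `m₀ = 2m/(3-m)` (so `α(3,3,m₀) - 1 = 1 - m`), then `weightedMorreyM_three_three_eq` on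
`0 < r < 1` (an eventual equality along `𝓝[>] 0`).
[cite: Seregin2025TypeIIScenario, Thm 1.1 with (1.1), (1.6) and Rem. 1.2 (i) (pp. 2–3); Seregin2026, Thm 2.1 (p. 5)] -/
theorem tendsto_cubic_seregin2025 (h : seregin2026_typeII_scenario_excluded)
    (hv : IsSuitableWeakSolutionInBall 1 0 v q)
    (hG : HasWeakSpatialGradientOn
      (parabolicCylinderOpens 1 (0 : ℝ × EuclideanSpace ℝ (Fin 3))) v G)
    (hm : m ∈ Ioo (0 : ℝ) 1)
    (hbound : ∃ M₁ : ℝ≥0, HasWeightedEnergyBound (fun r => r ^ (1 - m)) M₁ v q G) :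
    Tendsto
      (fun r : ℝ => ENNReal.ofReal (r ^ (-(2 * (2 * m / (3 - m))))) *
        ∫⁻ w in parabolicCylinder r (0 : ℝ × EuclideanSpace ℝ (Fin 3)), ‖v w.1 w.2‖ₑ ^ (3 : ℕ))
      (𝓝[>] 0) (𝓝 0) := by
  set m₀ : ℝ := 2 * m / (3 - m) with hm₀def
  have hm₀ : m₀ ∈ Ioo (0 : ℝ) 1 := m0_mem_Ioo hm
  have h3p : (3 : ℝ) < pEta 0 := by
    rw [pEta_zero]
    norm_num
  have h3q : (3 : ℝ) < qEta 0 := by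
    rw [qEta_zero]
    norm_num
  have hκ : 0 < kappa 3 3 := by
    rw [kappa_three_three]
    norm_num
  have hκl : kappa 3 3 < 3 := by
    rw [kappa_three_three]
    norm_num
  have hη : (0 : ℝ) ∈ Icc (0 : ℝ) 1 := ⟨le_rfl, zero_le_one⟩
  have hexp : alpha2023 3 3 m₀ - 1 = 1 - m := by
    rw [alpha2023_three_three_sub_one hm₀.1.le, hm₀def, m_eq_of_m0 (by linarith [hm.2])]
  have hbound' : ∃ M₁ : ℝ≥0,
      HasWeightedEnergyBound (fun r => r ^ (alpha2023 3 3 m₀ - 1)) M₁ v q G := by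
    rw [hexp]
    exact hbound
  have hlim := polynomial h hv hG (by norm_num : (1 : ℝ) < 3) (by norm_num : (1 : ℝ) < 3)
    hκ hκl hη h3p h3q hm₀ hbound'
  refine hlim.congr' ?_
  filter_upwards [Ioo_mem_nhdsGT (zero_lt_one' ℝ)] with r hr
  have hsub : parabolicCylinder r (0 : ℝ × EuclideanSpace ℝ (Fin 3)) ⊆
      (parabolicCylinderOpens 1 (0 : ℝ × EuclideanSpace ℝ (Fin 3)) :
        Set (ℝ × EuclideanSpace ℝ (Fin 3))) := by
    rw [coe_parabolicCylinderOpens]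
    have h2 : r ^ 2 ≤ 1 ^ 2 := pow_le_pow_left₀ hr.1.le hr.2.le 2
    exact prod_mono (Ioo_subset_Ioo (by linarith) le_rfl) (ball_subset_ball hr.2.le)
  have hmeas : AEStronglyMeasurable (uncurry v)
      (volume.restrict (parabolicCylinder r (0 : ℝ × EuclideanSpace ℝ (Fin 3)))) :=
    hG.locallyIntegrableOn.aestronglyMeasurable.mono_set hsub
  exact weightedMorreyM_three_three_eq hr.1 hmeas m₀

/-- The same limit through the tree's `C(v,r) = r^{-2} ∫_{Q(r)} |v|³` (`cknC`):
`r^{2-2m₀} C(v; Q(r)) → 0` as `r → 0⁺`, `m₀ = 2m/(3-m)`, under (1.1) of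
[Seregin2025TypeIIScenario] and [Seregin2026] Thm 2.1.
[cite: Seregin2025TypeIIScenario, Thm 1.1 (1.6) (p. 2); Seregin2026, Thm 2.1 (p. 5)] -/
theorem tendsto_cknC_seregin2025 (h : seregin2026_typeII_scenario_excluded)
    (hv : IsSuitableWeakSolutionInBall 1 0 v q)
    (hG : HasWeakSpatialGradientOn
      (parabolicCylinderOpens 1 (0 : ℝ × EuclideanSpace ℝ (Fin 3))) v G)
    (hm : m ∈ Ioo (0 : ℝ) 1)
    (hbound : ∃ M₁ : ℝ≥0, HasWeightedEnergyBound (fun r => r ^ (1 - m)) M₁ v q G) :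
    Tendsto
      (fun r : ℝ => ENNReal.ofReal (r ^ (2 - 2 * (2 * m / (3 - m)))) *
        cknC r (0 : ℝ × EuclideanSpace ℝ (Fin 3)) v)
      (𝓝[>] 0) (𝓝 0) := by
  refine (tendsto_cubic_seregin2025 h hv hG hm hbound).congr' ?_
  filter_upwards [self_mem_nhdsWithin] with r hr
  exact rpow_mul_lintegral_eq_rpow_mul_cknC hr _

end seregin2026_typeII_scenario_excluded


end Literature.Analysis.FluidPDE.Seregin2023
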